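import Summits.AtomisticToContinuum.FouriersLaw.Theorems.OddSectorIrreversibilityOddDensityIsCorrectorCoboundary
import Summits.AtomisticToContinuum.FouriersLaw.Theorems.OddSectorIrreversibilityOddDensityIsCorrectorAbelLimit
import Summits.AtomisticToContinuum.FouriersLaw.Theorems.OddSectorIrreversibilityOddDensityIsCorrectorMainPrep

/-!
# `OddDensityIsCorrector`, part 14: the Kubo integral of the McLennan source

Helper file for support item `stmt-AtomisticToContinuum-9146`
(`OddSectorIrreversibility.OddDensityIsCorrector`).

For the pinned anharmonic chain with both baths at `T > 0`, `N ≥ 2`, and the momentum-even potential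
`Ψ = X/((N-1)T²) - H/(2T²)` of part 13 (`LΨ = J_tot/((N-1)T²) + g`, `g` the McLennan source):

* growth bounds `|Ψ|, |LΨ| ≤ C e^{ϑH}` (`pinnedChain_abs_mclennanPotential_le`,
  `pinnedChain_abs_generator_mclennanPotential_le`);
* `μ_T(J_tot) = 0`, `μ_T(g) = 0` (`pinnedChain_integral_mclennanSource_gibbsMeasure`);
* the Kubo integrals split, `R₀(LΨ) = R₀(J_tot)/((N-1)T²) + R₀ g` pointwise
  (`pinnedChain_kubo_generator_mclennanPotential`);
* and `R₀(LΨ) = μ_T(Ψ) - Ψ` a.e. (`pinnedChain_kubo_generator_ae_eq`), from the resolvent coboundary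
  identity `R_λ(LΨ) = λR_λΨ - Ψ` (part 11) and the Abel limits with rates (part 10) along `λ = 1/(n+1)`.

Consequently `R₀ g = μ_T(Ψ) - Ψ - R₀(J_tot)/((N-1)T²)` a.e., whose momentum-odd part is
`-(R₀J_tot - R₀J_tot∘Θ)/((N-1)T²)`: this is the input of the assembly (part 15).
-/

noncomputable section

open MeasureTheory ProbabilityTheory Filter Topology Set Function
open scoped ContDiff NNReal ENNReal BigOperators
open Literature.MathematicalPhysics.KineticTheory.HeatConduction
open Literature.Barriers.AtomisticToContinuum.OpenChain
open Summit.AtomisticToContinuum.FouriersLaw.Theorems.SubdiffusiveBondHeat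

namespace Summit.AtomisticToContinuum.FouriersLaw.Theorems.OddSectorIrreversibility

variable {N : ℕ}

section Pinned

variable {ω₂ lam β γ : ℝ} (hω : 0 < ω₂) (hl : 0 ≤ lam) (hβ : 0 < β) (hγ : 0 < γ) (hN : 2 ≤ N)
  {T : ℝ} (hT : 0 < T)
include hω hl hβ hγ hN hT

omit hγ hN hT in
/-- **`Ψ` is nice**: `|X/((N-1)T²) - H/(2T²)| ≤ C_Ψ e^{ϑH}` (`ϑ > 0`). [folklore] -/
theorem pinnedChain_abs_mclennanPotential_le {ϑ : ℝ} (hϑ : 0 < ϑ) (y : PhaseSpace N) :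
    |(((N : ℝ) - 1) * T ^ 2)⁻¹ * energyMoment (pinnedChain ω₂ lam β γ) N y +
        (-(2 * T ^ 2)⁻¹) * (pinnedChain ω₂ lam β γ).hamiltonian N y| ≤
      ((|(((N : ℝ) - 1) * T ^ 2)⁻¹| * (2 * N) + |(2 * T ^ 2)⁻¹|) * (2 * Real.exp ϑ / ϑ ^ 2)) *
        Real.exp (ϑ * (pinnedChain ω₂ lam β γ).hamiltonian N y) := by
  set P := pinnedChain ω₂ lam β γ with hP
  set H := P.hamiltonian N y with hH
  have hH0 : 0 ≤ H := pinnedChain_hamiltonian_nonneg hω.le hl hβ.le γ N y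
  have hX := pinnedChain_abs_energyMoment_le hω hl hβ.le N (γ := γ) y
  have h1 := pinnedChain_one_add_hamiltonian_sq_le hω hl hβ.le N (γ := γ) hϑ y
  have hH1 : H ≤ (1 + H) ^ 2 := by nlinarith
  set a := (((N : ℝ) - 1) * T ^ 2)⁻¹ with ha
  set b := (2 * T ^ 2)⁻¹ with hb
  calc |a * energyMoment P N y + -b * H| ≤ |a * energyMoment P N y| + |-b * H| := abs_add_le _ _
    _ = |a| * |energyMoment P N y| + |b| * H := by rw [abs_mul, abs_mul, abs_neg, abs_of_nonneg hH0]
    _ ≤ |a| * (2 * N * H) + |b| * H := by gcongr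
    _ = (|a| * (2 * N) + |b|) * H := by ring
    _ ≤ (|a| * (2 * N) + |b|) * (2 * Real.exp ϑ / ϑ ^ 2 * Real.exp (ϑ * H)) :=
        mul_le_mul_of_nonneg_left (hH1.trans h1) (by positivity)
    _ = _ := by ring

omit hγ hT in
/-- **`LΨ` is nice**: `|L(X/((N-1)T²) - H/(2T²))| ≤ C_L e^{ϑH}` (`ϑ > 0`, `T ≠ 0`, `N ≥ 2`). [folklore] -/
theorem pinnedChain_abs_generator_mclennanPotential_le (hT' : T ≠ 0) {ϑ : ℝ} (hϑ : 0 < ϑ) (y : PhaseSpace N) :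
    |(pinnedChain ω₂ lam β γ).generator N T T (fun x => (((N : ℝ) - 1) * T ^ 2)⁻¹ * energyMoment (pinnedChain ω₂ lam β γ) N x +
        (-(2 * T ^ 2)⁻¹) * (pinnedChain ω₂ lam β γ).hamiltonian N x) y| ≤
      ((|(((N : ℝ) - 1) * T ^ 2)⁻¹| * (N * (N * ((3 + β) / 2)) * (2 * Real.exp ϑ / ϑ ^ 2))) +
          |γ| / T ^ 2 * (2 * Real.exp ϑ / ϑ ^ 2)) * Real.exp (ϑ * (pinnedChain ω₂ lam β γ).hamiltonian N y) := by
  rw [pinnedChain_generator_mclennanPotential hN T hT' y]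
  have hJ := pinnedChain_abs_totalCurrent_le hω hl hβ.le N (γ := γ) hϑ y
  have hg := pinnedChain_abs_mclennanSource_le hω hl hβ.le N (γ := γ) (T := T) hϑ ⟨0, by omega⟩ ⟨N - 1, by omega⟩ y
  calc _ ≤ |(((N : ℝ) - 1) * T ^ 2)⁻¹ * ∑ i : Fin N, (pinnedChain ω₂ lam β γ).bondCurrent N i y| +
        |γ / (2 * T ^ 2) * (y.2 ⟨0, by omega⟩ ^ 2 - y.2 ⟨N - 1, by omega⟩ ^ 2)| := abs_add_le _ _
    _ ≤ |(((N : ℝ) - 1) * T ^ 2)⁻¹| * ((N * (N * ((3 + β) / 2)) * (2 * Real.exp ϑ / ϑ ^ 2)) *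
          Real.exp (ϑ * (pinnedChain ω₂ lam β γ).hamiltonian N y)) +
        (|γ| / T ^ 2 * (2 * Real.exp ϑ / ϑ ^ 2)) * Real.exp (ϑ * (pinnedChain ω₂ lam β γ).hamiltonian N y) := by
        rw [abs_mul]; gcongr
    _ = _ := by ring

omit hγ hN in
/-- Each bond current is `μ_T`-integrable. [folklore] -/
theorem pinnedChain_integrable_bondCurrent_gibbsMeasure (i : Fin N) :
    Integrable ((pinnedChain ω₂ lam β γ).bondCurrent N i) ((pinnedChain ω₂ lam β γ).gibbsMeasure N T) := by
  have hϑ1 : 1 / (2 * T) < 1 / T := by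
    rw [one_div_lt_one_div (by positivity) hT]; linarith
  have hϑ0 : 0 < 1 / (2 * T) := by positivity
  refine integrable_of_abs_le_exp (pinnedChain_integrable_exp_mul_hamiltonian_gibbsMeasure hω hl hβ.le γ N hT hϑ1)
    (pinnedChain_continuous_bondCurrent ω₂ lam β γ N i) (C := N * ((3 + β) / 2) * (2 * Real.exp (1 / (2 * T)) / (1 / (2 * T)) ^ 2))
    fun y => ?_
  have h1 := pinnedChain_one_add_hamiltonian_sq_le hω hl hβ.le N (γ := γ) hϑ0 y
  have h2 := pinnedChain_abs_bondCurrent_le hω.le hl hβ.le γ N i y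
  have hβ3 : 0 ≤ (N : ℝ) * ((3 + β) / 2) := by have := hβ.le; positivity
  calc _ ≤ N * ((3 + β) / 2 * (1 + (pinnedChain ω₂ lam β γ).hamiltonian N y) ^ 2) := h2
    _ = N * ((3 + β) / 2) * (1 + (pinnedChain ω₂ lam β γ).hamiltonian N y) ^ 2 := by ring
    _ ≤ N * ((3 + β) / 2) * (2 * Real.exp (1 / (2 * T)) / (1 / (2 * T)) ^ 2 *
          Real.exp ((1 / (2 * T)) * (pinnedChain ω₂ lam β γ).hamiltonian N y)) := mul_le_mul_of_nonneg_left h1 hβ3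
    _ = _ := by ring

omit hγ hN in
/-- `μ_T(J_tot) = 0`. [folklore] -/
theorem pinnedChain_integral_totalCurrent_gibbsMeasure :
    ∫ y, (∑ i : Fin N, (pinnedChain ω₂ lam β γ).bondCurrent N i y) ∂((pinnedChain ω₂ lam β γ).gibbsMeasure N T) = 0 := by
  rw [integral_finsetSum _ fun i _ => pinnedChain_integrable_bondCurrent_gibbsMeasure hω hl hβ hT i]
  exact Finset.sum_eq_zero fun i _ => pinnedChain_integral_bondCurrent_gibbsMeasure ω₂ lam β γ N T i

/-- **The McLennan source is centred**: `μ_T(g) = 0`, `g = γ(p_0² - p_{N-1}²)/(2T²)` — from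
`μ_T(LΨ) = 0` (part 11), `LΨ = J_tot/((N-1)T²) + g` (part 13) and `μ_T(J_tot) = 0`.
(Also clear by the `p_0 ↔ p_{N-1}`-free Gaussian symmetry; this route avoids computing moments.)
[folklore] -/
theorem pinnedChain_integral_mclennanSource_gibbsMeasure :
    ∫ y, γ / (2 * T ^ 2) * (y.2 ⟨0, by omega⟩ ^ 2 - y.2 ⟨N - 1, by omega⟩ ^ 2) ∂((pinnedChain ω₂ lam β γ).gibbsMeasure N T) = 0 := by
  set P := pinnedChain ω₂ lam β γ with hP
  set π := P.gibbsMeasure N T with hπ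
  set ϑ : ℝ := 1 / (4 * T) with hϑ
  have hϑ0 : 0 < ϑ := by positivity
  have h2ϑ : 2 * ϑ < 1 / T := by
    rw [hϑ, show 2 * (1 / (4 * T)) = 1 / (2 * T) by field_simp; ring, one_div_lt_one_div (by positivity) hT]; linarith
  have hϑ1 : ϑ < 1 / T := by linarith
  have hU : ContDiff ℝ ∞ P.U := pinnedChain_contDiff_U ω₂ lam β γ
  have hV : ContDiff ℝ ∞ P.V := pinnedChain_contDiff_V ω₂ lam β γ
  have hΨ2 : ContDiff ℝ 2 (fun x => (((N : ℝ) - 1) * T ^ 2)⁻¹ * energyMoment P N x + (-(2 * T ^ 2)⁻¹) * P.hamiltonian N x) :=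
    (contDiff_const.mul ((contDiff_energyMoment P hU hV N).of_le (by norm_cast))).add
      (contDiff_const.mul ((P.contDiff_hamiltonian hU hV N).of_le (by norm_cast)))
  have h0 := pinnedChain_integral_generator_gibbsMeasure_eq_zero hω hl hβ hγ hN hT hϑ0 h2ϑ hΨ2 (by positivity) (by positivity)
    (pinnedChain_abs_mclennanPotential_le hω hl hβ hϑ0) (pinnedChain_abs_generator_mclennanPotential_le hω hl hβ hN hT.ne' hϑ0)
  have hpt : ∀ y, P.generator N T T (fun x => (((N : ℝ) - 1) * T ^ 2)⁻¹ * energyMoment P N x + (-(2 * T ^ 2)⁻¹) * P.hamiltonian N x) y =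
      (((N : ℝ) - 1) * T ^ 2)⁻¹ * (∑ i : Fin N, P.bondCurrent N i y) +
        γ / (2 * T ^ 2) * (y.2 ⟨0, by omega⟩ ^ 2 - y.2 ⟨N - 1, by omega⟩ ^ 2) :=
    fun y => pinnedChain_generator_mclennanPotential hN T hT.ne' y
  rw [integral_congr_ae (Eventually.of_forall hpt)] at h0
  have iJ : Integrable (fun y => ∑ i : Fin N, P.bondCurrent N i y) π :=
    integrable_finsetSum _ fun i _ => pinnedChain_integrable_bondCurrent_gibbsMeasure hω hl hβ hT i
  have ig : Integrable (fun y : PhaseSpace N => γ / (2 * T ^ 2) * (y.2 ⟨0, by omega⟩ ^ 2 - y.2 ⟨N - 1, by omega⟩ ^ 2)) π := by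
    have hc : Continuous fun y : PhaseSpace N => γ / (2 * T ^ 2) * (y.2 ⟨0, by omega⟩ ^ 2 - y.2 ⟨N - 1, by omega⟩ ^ 2) := by
      fun_prop
    exact integrable_of_abs_le_exp (pinnedChain_integrable_exp_mul_hamiltonian_gibbsMeasure hω hl hβ.le γ N hT hϑ1) hc
      (pinnedChain_abs_mclennanSource_le hω hl hβ.le N hϑ0 ⟨0, by omega⟩ ⟨N - 1, by omega⟩)
  rw [integral_add (iJ.const_mul _) ig, integral_const_mul, pinnedChain_integral_totalCurrent_gibbsMeasure hω hl hβ hT,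
    mul_zero, zero_add] at h0
  exact h0

/-- **The Kubo integrals split**: `R₀(LΨ)(z) = R₀(J_tot)(z)/((N-1)T²) + R₀ g(z)` for every `z`
(linearity of `P_t` and of the absolutely convergent Kubo integrals of the centred nice observables
`J_tot`, `g`). [folklore] -/
theorem pinnedChain_kubo_generator_mclennanPotential (z : PhaseSpace N) :
    ∫ t in Ioi (0 : ℝ), ∫ y, (pinnedChain ω₂ lam β γ).generator N T T
        (fun x => (((N : ℝ) - 1) * T ^ 2)⁻¹ * energyMoment (pinnedChain ω₂ lam β γ) N x +
          (-(2 * T ^ 2)⁻¹) * (pinnedChain ω₂ lam β γ).hamiltonian N x) y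
        ∂((pinnedChain ω₂ lam β γ).transitionKernel N T T t.toNNReal z) =
      (((N : ℝ) - 1) * T ^ 2)⁻¹ * (∫ t in Ioi (0 : ℝ), ∫ y, (∑ i : Fin N, (pinnedChain ω₂ lam β γ).bondCurrent N i y)
          ∂((pinnedChain ω₂ lam β γ).transitionKernel N T T t.toNNReal z)) +
        ∫ t in Ioi (0 : ℝ), ∫ y, γ / (2 * T ^ 2) * (y.2 ⟨0, by omega⟩ ^ 2 - y.2 ⟨N - 1, by omega⟩ ^ 2)
          ∂((pinnedChain ω₂ lam β γ).transitionKernel N T T t.toNNReal z) := by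
  set P := pinnedChain ω₂ lam β γ with hP
  have hN0 : 0 < N := by omega
  set ϑ : ℝ := 1 / (4 * T) with hϑ
  have hϑ0 : 0 < ϑ := by positivity
  have h2ϑ : 2 * ϑ < 1 / T := by
    rw [hϑ, show 2 * (1 / (4 * T)) = 1 / (2 * T) by field_simp; ring, one_div_lt_one_div (by positivity) hT]; linarith
  have hϑ1 : ϑ < 1 / T := by linarith
  obtain ⟨K, c, hK, hc, hb⟩ := pinnedChain_harris_bound hω hl hβ hγ hN0 hT hϑ0 hϑ1
  have hpt : ∀ y, P.generator N T T (fun x => (((N : ℝ) - 1) * T ^ 2)⁻¹ * energyMoment P N x + (-(2 * T ^ 2)⁻¹) * P.hamiltonian N x) y =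
      (((N : ℝ) - 1) * T ^ 2)⁻¹ * (∑ i : Fin N, P.bondCurrent N i y) +
        γ / (2 * T ^ 2) * (y.2 ⟨0, by omega⟩ ^ 2 - y.2 ⟨N - 1, by omega⟩ ^ 2) :=
    fun y => pinnedChain_generator_mclennanPotential hN T hT.ne' y
  have hJc : Continuous fun y => ∑ i : Fin N, P.bondCurrent N i y :=
    continuous_finsetSum _ fun i _ => pinnedChain_continuous_bondCurrent ω₂ lam β γ N i
  have hJb := pinnedChain_abs_totalCurrent_le hω hl hβ.le N (γ := γ) hϑ0
  have hgc : Continuous fun y : PhaseSpace N => γ / (2 * T ^ 2) * (y.2 ⟨0, by omega⟩ ^ 2 - y.2 ⟨N - 1, by omega⟩ ^ 2) := by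
    fun_prop
  have hgb := pinnedChain_abs_mclennanSource_le hω hl hβ.le N (γ := γ) (T := T) hϑ0 ⟨0, by omega⟩ ⟨N - 1, by omega⟩
  have hJ'c : Continuous fun y => (((N : ℝ) - 1) * T ^ 2)⁻¹ * ∑ i : Fin N, P.bondCurrent N i y := continuous_const.mul hJc
  have hJ'b : ∀ y, |(((N : ℝ) - 1) * T ^ 2)⁻¹ * ∑ i : Fin N, P.bondCurrent N i y| ≤
      |(((N : ℝ) - 1) * T ^ 2)⁻¹| * (N * (N * ((3 + β) / 2)) * (2 * Real.exp ϑ / ϑ ^ 2)) * Real.exp (ϑ * P.hamiltonian N y) :=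
    fun y => by rw [abs_mul, mul_assoc]; exact mul_le_mul_of_nonneg_left (hJb y) (abs_nonneg _)
  have hsplit : (fun t : ℝ => ∫ y, P.generator N T T (fun x => (((N : ℝ) - 1) * T ^ 2)⁻¹ * energyMoment P N x +
      (-(2 * T ^ 2)⁻¹) * P.hamiltonian N x) y ∂(P.transitionKernel N T T t.toNNReal z)) =
      fun t : ℝ => (((N : ℝ) - 1) * T ^ 2)⁻¹ * (∫ y, (∑ i : Fin N, P.bondCurrent N i y) ∂(P.transitionKernel N T T t.toNNReal z)) +
        ∫ y, γ / (2 * T ^ 2) * (y.2 ⟨0, by omega⟩ ^ 2 - y.2 ⟨N - 1, by omega⟩ ^ 2) ∂(P.transitionKernel N T T t.toNNReal z) := by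
    funext t
    rw [integral_congr_ae (Eventually.of_forall hpt), pinnedChain_act_add hω hl hN0 hT hβ.le hγ.le hϑ0 hϑ1 hJ'c hgc hJ'b hgb,
      integral_const_mul]
  rw [hsplit]
  have hJ0 := pinnedChain_integral_totalCurrent_gibbsMeasure hω hl hβ hT (N := N) (γ := γ)
  have hg0 := pinnedChain_integral_mclennanSource_gibbsMeasure hω hl hβ hγ hN hT
  have iJ := (pinnedChain_integrableOn_kubo hω hl hβ hγ hb hc hJc (by have := hβ.le; positivity) hJb hJ0 z).1
  have ig := (pinnedChain_integrableOn_kubo hω hl hβ hγ hb hc hgc (by positivity) hgb hg0 z).1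
  rw [integral_add (iJ.const_mul _) ig, integral_const_mul]

/-- **`R₀(LΨ) = μ_T(Ψ) - Ψ` almost everywhere** for `Ψ = X/((N-1)T²) - H/(2T²)`: the Kubo integral of
`LΨ` is the coboundary `μ_T(Ψ) - Ψ` (resolvent coboundary identity `R_λ(LΨ) = λR_λΨ - Ψ` a.e. for
`λ = 1/(n+1)`, and the Abel limits `R_λ(LΨ) → R₀(LΨ)`, `λR_λΨ → μ_T(Ψ)` with rates).
[cite: KunduDharNarayan2009, eq. (reln3)] -/
theorem pinnedChain_kubo_generator_ae_eq :
    ∀ᵐ z ∂((pinnedChain ω₂ lam β γ).gibbsMeasure N T),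
      ∫ t in Ioi (0 : ℝ), ∫ y, (pinnedChain ω₂ lam β γ).generator N T T
        (fun x => (((N : ℝ) - 1) * T ^ 2)⁻¹ * energyMoment (pinnedChain ω₂ lam β γ) N x +
          (-(2 * T ^ 2)⁻¹) * (pinnedChain ω₂ lam β γ).hamiltonian N x) y
        ∂((pinnedChain ω₂ lam β γ).transitionKernel N T T t.toNNReal z) =
      (∫ x, ((((N : ℝ) - 1) * T ^ 2)⁻¹ * energyMoment (pinnedChain ω₂ lam β γ) N x +
          (-(2 * T ^ 2)⁻¹) * (pinnedChain ω₂ lam β γ).hamiltonian N x) ∂((pinnedChain ω₂ lam β γ).gibbsMeasure N T)) -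
        ((((N : ℝ) - 1) * T ^ 2)⁻¹ * energyMoment (pinnedChain ω₂ lam β γ) N z +
          (-(2 * T ^ 2)⁻¹) * (pinnedChain ω₂ lam β γ).hamiltonian N z) := by
  set P := pinnedChain ω₂ lam β γ with hP
  set π := P.gibbsMeasure N T with hπ
  have hN0 : 0 < N := by omega
  set ϑ : ℝ := 1 / (4 * T) with hϑ
  have hϑ0 : 0 < ϑ := by positivity
  have h2ϑ : 2 * ϑ < 1 / T := by
    rw [hϑ, show 2 * (1 / (4 * T)) = 1 / (2 * T) by field_simp; ring, one_div_lt_one_div (by positivity) hT]; linarith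
  have hϑ1 : ϑ < 1 / T := by linarith
  obtain ⟨K, c, hK, hc, hb⟩ := pinnedChain_harris_bound hω hl hβ hγ hN0 hT hϑ0 hϑ1
  have hU : ContDiff ℝ ∞ P.U := pinnedChain_contDiff_U ω₂ lam β γ
  have hV : ContDiff ℝ ∞ P.V := pinnedChain_contDiff_V ω₂ lam β γ
  obtain ⟨Ψ, hΨ⟩ : ∃ Ψ : PhaseSpace N → ℝ, Ψ = fun x => (((N : ℝ) - 1) * T ^ 2)⁻¹ * energyMoment P N x +
      (-(2 * T ^ 2)⁻¹) * P.hamiltonian N x := ⟨_, rfl⟩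
  have hΨ2 : ContDiff ℝ 2 Ψ := by
    rw [hΨ]
    exact (contDiff_const.mul ((contDiff_energyMoment P hU hV N).of_le (by norm_cast))).add
      (contDiff_const.mul ((P.contDiff_hamiltonian hU hV N).of_le (by norm_cast)))
  set CΨ := (|(((N : ℝ) - 1) * T ^ 2)⁻¹| * (2 * N) + |(2 * T ^ 2)⁻¹|) * (2 * Real.exp ϑ / ϑ ^ 2) with hCΨ
  set CL := (|(((N : ℝ) - 1) * T ^ 2)⁻¹| * (N * (N * ((3 + β) / 2)) * (2 * Real.exp ϑ / ϑ ^ 2))) +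
    |γ| / T ^ 2 * (2 * Real.exp ϑ / ϑ ^ 2) with hCL
  have hCΨ0 : 0 ≤ CΨ := by positivity
  have hCL0 : 0 ≤ CL := by have := hβ.le; positivity
  have hΨb : ∀ y, |Ψ y| ≤ CΨ * Real.exp (ϑ * P.hamiltonian N y) := fun y => by
    rw [hΨ]; exact pinnedChain_abs_mclennanPotential_le hω hl hβ hϑ0 y
  have hLb : ∀ y, |P.generator N T T Ψ y| ≤ CL * Real.exp (ϑ * P.hamiltonian N y) := fun y => by
    rw [hΨ]; exact pinnedChain_abs_generator_mclennanPotential_le hω hl hβ hN hT.ne' hϑ0 y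
  have hLc : Continuous (P.generator N T T Ψ) :=
    P.continuous_generator (hU.of_le (by norm_cast)) (hV.of_le (by norm_cast)) N T T hΨ2
  have hL0 : ∫ y, P.generator N T T Ψ y ∂π = 0 :=
    pinnedChain_integral_generator_gibbsMeasure_eq_zero hω hl hβ hγ hN hT hϑ0 h2ϑ hΨ2 hCΨ0 hCL0 hΨb hLb
  -- the coboundary identities along `λ = 1/(n+1)`
  have hcob : ∀ n : ℕ, ∀ᵐ z ∂π, (∫ t in Ioi (0 : ℝ), Real.exp (-((1 / ((n : ℝ) + 1)) * t)) *
      ∫ y, P.generator N T T Ψ y ∂(P.transitionKernel N T T t.toNNReal z)) =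
      (1 / ((n : ℝ) + 1)) * (∫ t in Ioi (0 : ℝ), Real.exp (-((1 / ((n : ℝ) + 1)) * t)) *
        ∫ y, Ψ y ∂(P.transitionKernel N T T t.toNNReal z)) - Ψ z :=
    fun n => pinnedChain_resolvent_coboundary hω hl hβ hγ hN hT hϑ0 h2ϑ hΨ2 hCΨ0 hCL0 hΨb hLb (by positivity)
  have hall := ae_all_iff.2 hcob
  have hfold : ∀ᵐ z ∂π, ∫ t in Ioi (0 : ℝ), ∫ y, P.generator N T T Ψ y ∂(P.transitionKernel N T T t.toNNReal z) =
      (∫ x, Ψ x ∂π) - Ψ z → ∫ t in Ioi (0 : ℝ), ∫ y, P.generator N T T (fun x => (((N : ℝ) - 1) * T ^ 2)⁻¹ * energyMoment P N x +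
          (-(2 * T ^ 2)⁻¹) * P.hamiltonian N x) y ∂(P.transitionKernel N T T t.toNNReal z) =
      (∫ x, ((((N : ℝ) - 1) * T ^ 2)⁻¹ * energyMoment P N x + (-(2 * T ^ 2)⁻¹) * P.hamiltonian N x) ∂π) -
        ((((N : ℝ) - 1) * T ^ 2)⁻¹ * energyMoment P N z + (-(2 * T ^ 2)⁻¹) * P.hamiltonian N z) :=
    Eventually.of_forall fun z hz => by rw [hΨ] at hz; exact hz
  refine (Eventually.and hall hfold).mono fun z hz' => hz'.2 ?_
  have hz := hz'.1
  set E := Real.exp (ϑ * P.hamiltonian N z) with hE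
  apply eq_of_sub_eq_zero
  apply eq_zero_of_abs_le_mul_eps (c := K * CL * E / c ^ 2 + K * CΨ * E / c)
  intro ε hε
  obtain ⟨n, hn⟩ := exists_nat_one_div_lt hε
  have hlam : (0 : ℝ) < 1 / ((n : ℝ) + 1) := by positivity
  have e1 := pinnedChain_abs_resolvent_sub_kubo_le hω hl hβ hγ hϑ0 hb hc hLc hCL0 hLb hL0 hlam z
  have e2 := pinnedChain_abs_abelMean_sub_le hω hl hβ hγ hϑ0 hb hc hΨ2.continuous hCΨ0 hΨb hlam z
  rw [hz n] at e1
  rw [abs_sub_comm] at e1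
  have hM : 0 ≤ K * CL * E / c ^ 2 + K * CΨ * E / c := by positivity
  calc _ ≤ |(∫ t in Ioi (0 : ℝ), ∫ y, P.generator N T T Ψ y ∂(P.transitionKernel N T T t.toNNReal z)) -
          ((1 / ((n : ℝ) + 1)) * (∫ t in Ioi (0 : ℝ), Real.exp (-((1 / ((n : ℝ) + 1)) * t)) *
            ∫ y, Ψ y ∂(P.transitionKernel N T T t.toNNReal z)) - Ψ z)| +
        |(1 / ((n : ℝ) + 1)) * (∫ t in Ioi (0 : ℝ), Real.exp (-((1 / ((n : ℝ) + 1)) * t)) *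
            ∫ y, Ψ y ∂(P.transitionKernel N T T t.toNNReal z)) - ∫ x, Ψ x ∂π| := by
        refine le_trans (le_of_eq ?_) (abs_add_le _ _)
        congr 1; ring
    _ ≤ (1 / ((n : ℝ) + 1)) * (K * CL * E) / c ^ 2 + (1 / ((n : ℝ) + 1)) * (K * CΨ * E) / c := add_le_add e1 e2
    _ = (K * CL * E / c ^ 2 + K * CΨ * E / c) * (1 / ((n : ℝ) + 1)) := by ring
    _ ≤ (K * CL * E / c ^ 2 + K * CΨ * E / c) * ε := mul_le_mul_of_nonneg_left hn.le hM

end Pinned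

end Summit.AtomisticToContinuum.FouriersLaw.Theorems.OddSectorIrreversibility

end
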